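import Literature.NumberTheory.Transcendental.GammaFieldsEcl
import Literature.NumberTheory.Transcendental.KirbyWeakSchanuelAx
import HarnessLib

/-!
# The transcendence bound for Khovanskii systems (Kirby 2010, Prop. 4.7 / Lemma 4.8)

J. Kirby, *Exponential algebraicity in exponential fields*, Bull. Lond. Math. Soc. 42 (2010)
879–890, Prop. 4.7, Lemma 4.8 and §7 (proof of Thm. 1.3): if `x̄ ∈ Fⁿ` is a non-degenerate solution
of a Khovanskii system `fᵢ(x̄, e^{x̄}) = 0` (`i < n`, non-vanishing exponential Jacobian) whose
coefficients lie in the Γ-field `L = ℚ(Λ, exp Λ)` of a `ℚ`-subspace `Λ ≤ F`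
(`GammaField.fieldOf`), and every `xⱼ` lies in `Λ + ℚ·{x_{ρ s} : s < k}` for a sub-tuple `x ∘ ρ` of
length `k`, then `trdeg_L L(x̄, exp x̄) ≤ k`.

This is the statement of `GammaField.trdeg_adjoin_le_of_khovanskii`
(`Literature/NumberTheory/Transcendental/EclPredim.lean`), proved again, verbatim up to names, over
an import cone the Lean farm BUILDS (`GammaFieldsEcl`, `KirbyWeakSchanuelAx` ⊇ `DerivationExtension`,
`AxDerivationTools`, `KirbyEDerivations`): `EclPredim.lean` imports `ZilberFieldSaturationMain`,
`EclExchangeProofs`, `AxSchanuelProofs`, `GammaKummerLevels`, a cone that is stale on the farm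
(`lean check` answers `remote:stale:…:unbuilt:Literature.NumberTheory.Transcendental.AxSchanuelUniv`,
2026-08-30), so no Summits-side file can currently use the bound. The two auxiliary inputs of the
`EclPredim` proof that live in that cone are re-proved here as well: the chain rule through a
Khovanskii system for a derivation exponential on the solution
(`EclExchangeProofs.derivation_apply_eq_zero_of_khovanskii` ↦ `derivation_apply_eq_zero_of_khovanskii_sol`)
and a common-denominator lemma (`GammaKummerLevels.exists_common_den` ↦ `exists_common_den_fin`).
Declarations live in the namespace `Literature.NumberTheory.Transcendental.KhovanskiiBound`, so nothing
clashes with `EclPredim.lean`; once that cone builds again, `EclPredim` can import this file and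
drop its copies.

* `KhovanskiiBound.derivation_apply_eq_zero_of_khovanskii_sol` — Kirby 2010, Prop. 4.7 (chain rule).
* `KhovanskiiBound.trdeg_adjoin_le_of_khovanskii` — the bound `trdeg_L L(x̄, exp x̄) ≤ k` (proof: the
  `M`-linear map sending an `L`-derivation `D` of `M = L(x̄, exp x̄)` to its exponential defects
  `(D e^{x_{ρ s}} - e^{x_{ρ s}} D x_{ρ s})_{s < k}` is injective — vanishing defects propagate along the
  `ℚ`-linear relations modulo `Λ`, then the chain rule applied to an extension of `D` to `F`
  (`Derivation.exists_extension_of_charZero`) kills `x̄` — and `trdeg_L M ≤ dim_M Der_L(M)`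
  (`trdeg_le_finrank_derivation`)).

Generic over any exponential field of characteristic zero. No `sorry`, no new definitions, no
instances, no notation.
-/

noncomputable section

open Set MvPolynomial

universe u

namespace Literature.NumberTheory.Transcendental.KhovanskiiBound
open Literature.NumberTheory.Transcendental Literature.NumberTheory.Transcendental.GammaField
open Literature.ModelTheory.ExponentialFields Literature.ModelTheory.ExponentialFields.ExponentialRing

variable {F : Type u} [Field F] [CharZero F] [ExponentialRing F]

/-- A common denominator for a rational vector (the statement of `GammaKummerLevels.exists_common_den`, whose module is outside this file's
import cone). [folklore] -/
private theorem exists_common_den_fin {n : ℕ} (q : Fin n → ℚ) :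
    ∃ d : ℕ, 0 < d ∧ ∃ v : Fin n → ℤ, ∀ s, (d : ℚ) * q s = v s := by
  classical
  refine ⟨∏ s, (q s).den, Finset.prod_pos fun s _ => (q s).den_pos, fun s =>
    (∏ t ∈ Finset.univ.erase s, ((q t).den : ℤ)) * (q s).num, fun s => ?_⟩
  rw [← Finset.prod_erase_mul _ _ (Finset.mem_univ s), Nat.cast_mul, mul_assoc,
    show ((q s).den : ℚ) * q s = (q s).num by rw [mul_comm, Rat.mul_den_eq_num]]
  push_cast
  ring

omit [CharZero F] in
/-- **Kirby 2010, Prop. 4.7, for derivations exponential on the solution only** (the statement of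
`EclExchangeProofs.derivation_apply_eq_zero_of_khovanskii`, re-proved here because that module's
import cone — `KirbyDerivationExtension` … `AxSchanuelUniv` — is not built on the farm). If `x̄` solves the Khovanskii system
`fᵢ(x̄, e^{x̄}) = 0` (coefficients in `ℤ[S]`, non-vanishing exponential Jacobian `J`) and `D` is a
derivation of `F` vanishing on `S` with `D(e^{xⱼ}) = e^{xⱼ} D xⱼ` for all `j`, then `J · (D xⱼ)ⱼ = 0` by
the chain rule, so `D xⱼ = 0` for all `j`. [cite: Kirby2010, Prop. 4.7] -/
theorem derivation_apply_eq_zero_of_khovanskii_sol {S : Set F} {n : ℕ} {x : Fin n → F}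
    {f : Fin n → MvPolynomial (Fin n ⊕ Fin n) F}
    (hcoeff : ∀ i m, (f i).coeff m ∈ Subring.closure S)
    (heval : ∀ i, eval (Sum.elim x (exp ∘ x)) (f i) = 0)
    (hdet : (Matrix.of fun i j => eval (Sum.elim x (exp ∘ x)) (expPDeriv j (f i))).det ≠ 0)
    (D : Derivation ℤ F F) (hDS : ∀ s ∈ S, D s = 0)
    (hDE : ∀ j, D (exp (x j)) = exp (x j) * D (x j)) (j : Fin n) :
    D (x j) = 0 := by
  classical
  set R : Subring F := Subring.closure S
  have hR : ∀ s ∈ R, D s = 0 := fun s hs => derivation_eq_zero_of_mem_closure hDS hs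
  -- lift the polynomials to `R`
  have hlift : ∀ i, ∃ g : MvPolynomial (Fin n ⊕ Fin n) R, map R.subtype g = f i := by
    intro i
    show f i ∈ Set.range (map R.subtype)
    rw [mem_range_map_iff_coeffs_subset]
    intro c hc
    obtain ⟨m, -, rfl⟩ := mem_coeffs_iff.mp (Finset.mem_coe.mp hc)
    exact ⟨⟨_, hcoeff i m⟩, rfl⟩
  choose g hg using hlift
  set z : Fin n ⊕ Fin n → F := Sum.elim x (exp ∘ x) with hz
  -- the chain rule for each equation
  have hchain : ∀ i, ∑ j', eval z (expPDeriv j' (f i)) * D (x j') = 0 := by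
    intro i
    have hmap : ∀ p : MvPolynomial (Fin n ⊕ Fin n) R,
        eval z (map R.subtype p) = aeval (R := R) (S₁ := F) z p :=
      fun p => by rw [eval_map, aeval_def]; rfl
    have h := derivation_mvPolynomial_aeval (derivationOfSubring R D hR) z (g i)
    rw [derivationOfSubring_apply, Fintype.sum_sum_type, ← hmap, hg, heval i, map_zero] at h
    rw [h, ← Finset.sum_add_distrib]
    refine Finset.sum_congr rfl fun j' _ => ?_
    rw [derivationOfSubring_apply, derivationOfSubring_apply, smul_eq_mul, smul_eq_mul, ← hg,
      expPDeriv, pderiv_map, pderiv_map, map_add, map_mul, MvPolynomial.eval_X, hmap, hmap]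
    have hj : D (z (Sum.inr j')) = exp (x j') * D (x j') := hDE j'
    rw [hj, show z (Sum.inl j') = x j' from rfl, show z (Sum.inr j') = exp (x j') from rfl]
    ring
  set J : Matrix (Fin n) (Fin n) F := Matrix.of fun i j' => eval z (expPDeriv j' (f i))
  have hJ : J.mulVec (fun j' => D (x j')) = 0 := by
    ext i
    rw [Matrix.mulVec, Pi.zero_apply, ← hchain i]
    rfl
  have := Matrix.eq_zero_of_mulVec_eq_zero hdet hJ
  exact congr_fun this j

section TrdegBound

variable (Λ : Submodule ℚ F) {S : Set F} {n : ℕ} {x : Fin n → F}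
  {f : Fin n → MvPolynomial (Fin n ⊕ Fin n) F}

/-- `exp (m • b) ∈ ℚ(Λ, exp Λ)` for `b ∈ Λ`. [folklore] -/
private theorem exp_natCast_mul_mem_fieldOf {b : F} (hb : b ∈ Λ) (m : ℕ) :
    exp ((m : F) * b) ∈ fieldOf Λ := by
  refine exp_mem_fieldOf ?_
  rw [show (m : F) * b = (m : ℚ) • b by rw [Nat.cast_smul_eq_nsmul, nsmul_eq_mul]]
  exact Λ.smul_mem _ hb

set_option maxHeartbeats 800000 in
/-- The bound with the generating set written as `range (Sum.elim x (exp ∘ x))` (the literal form of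
`GammaField.trdeg_adjoin_le_of_khovanskii` in `EclPredim.lean`, whose import cone is not built on the farm); the public
statement below uses `range x ∪ range (exp ∘ x)`. [cite: Kirby2010, Prop. 4.7, Lemma 4.8] -/
private theorem trdeg_adjoin_le_of_khovanskii_sumElim (hS : S ⊆ (fieldOf Λ : Set F))
    (hcoeff : ∀ i m, (f i).coeff m ∈ Subring.closure S)
    (heval : ∀ i, eval (Sum.elim x (exp ∘ x)) (f i) = 0)
    (hdet : (Matrix.of fun i j => eval (Sum.elim x (exp ∘ x)) (expPDeriv j (f i))).det ≠ 0)
    {k : ℕ} {ρ : Fin k → Fin n}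
    (hspan : ∀ j, x j ∈ Λ ⊔ Submodule.span ℚ (range (x ∘ ρ))) :
    Algebra.trdeg (fieldOf Λ)
        (IntermediateField.adjoin (fieldOf Λ) (range (Sum.elim x (exp ∘ x)))) ≤ k := by
  classical
  set L : IntermediateField ℚ F := fieldOf Λ with hL
  set z : Fin n ⊕ Fin n → F := Sum.elim x (exp ∘ x) with hz
  set M : IntermediateField L F := IntermediateField.adjoin L (range z) with hM
  haveI : CharZero L := charZero_of_injective_algebraMap (algebraMap ℚ L).injective
  haveI : CharZero M := charZero_of_injective_algebraMap (algebraMap ℚ M).injective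
  -- the generators inside `M`
  let zM : Fin n ⊕ Fin n → M := fun s => ⟨z s, IntermediateField.subset_adjoin L _ ⟨s, rfl⟩⟩
  let xM : Fin n → M := fun j => zM (Sum.inl j)
  let yM : Fin n → M := fun j => zM (Sum.inr j)
  have hxM : ∀ j, ((xM j : M) : F) = x j := fun j => rfl
  have hyM : ∀ j, ((yM j : M) : F) = exp (x j) := fun j => rfl
  have hy0 : ∀ j, yM j ≠ 0 := fun j h => exp_ne_zero (x j) (by rw [← hyM j, h]; rfl)
  have hamap : ∀ y : L, ((algebraMap L M y : M) : F) = (y : F) := fun _ => rfl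
  -- the defect map
  let Φ : Derivation L M M →ₗ[M] (Fin k → M) :=
    { toFun := fun D s => D (yM (ρ s)) - yM (ρ s) * D (xM (ρ s))
      map_add' := fun D₁ D₂ => by
        funext s
        simp only [Derivation.coe_add, Pi.add_apply]
        ring
      map_smul' := fun a D => by
        funext s
        simp only [Derivation.coe_smul, Pi.smul_apply, smul_eq_mul, RingHom.id_apply]
        ring }
  have hΦ : ∀ D s, Φ D s = D (yM (ρ s)) - yM (ρ s) * D (xM (ρ s)) := fun _ _ => rfl
  -- vanishing defects on `x ∘ ρ` propagate to all of `x̄`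
  have key : ∀ D : Derivation L M M, Φ D = 0 → ∀ j, D (yM j) = yM j * D (xM j) := by
    intro D hD j
    have hDρ : ∀ s, D (yM (ρ s)) = yM (ρ s) * D (xM (ρ s)) := fun s => by
      have := congrFun hD s
      rw [hΦ, Pi.zero_apply, sub_eq_zero] at this
      exact this
    -- the relation `m xⱼ = m b + Σ vₛ x_{ρ s}`, `b ∈ Λ`, `vₛ ∈ ℤ`, `m ≥ 1`
    obtain ⟨b, hb, w, hw, hsum⟩ := Submodule.mem_sup.1 (hspan j)
    obtain ⟨q, rfl⟩ := (Submodule.mem_span_range_iff_exists_fun ℚ).1 hw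
    obtain ⟨m, hm, v, hv⟩ := exists_common_den_fin q
    have haddF : (m : F) * x j = (m : F) * b + ∑ s, (v s : F) * x (ρ s) := by
      rw [← hsum, mul_add, Finset.mul_sum]
      congr 1
      refine Finset.sum_congr rfl fun s _ => ?_
      rw [Function.comp_apply, Rat.smul_def, ← mul_assoc, ← Rat.cast_natCast, ← Rat.cast_mul, hv s,
        Rat.cast_intCast]
    have hbL : (m : F) * b ∈ L := by
      refine mem_fieldOf_of_mem ?_
      rw [show (m : F) * b = (m : ℚ) • b by rw [Nat.cast_smul_eq_nsmul, nsmul_eq_mul]]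
      exact Λ.smul_mem _ hb
    have hcL : exp ((m : F) * b) ∈ L := exp_natCast_mul_mem_fieldOf Λ hb m
    -- additive relation in `M` and its derivative
    have haddM : (∑ s, (v s : M) * xM (ρ s)) = (m : M) * xM j - algebraMap L M ⟨(m : F) * b, hbL⟩ := by
      rw [eq_sub_iff_add_eq]
      apply Subtype.ext
      simp only [AddMemClass.coe_add, MulMemClass.coe_mul, hamap]
      rw [AddSubmonoidClass.coe_finsetSum]
      simp only [MulMemClass.coe_mul]
      have e1 : ∀ s, (((v s : M) : M) : F) = (v s : F) := fun s => by simp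
      have e2 : (((m : M) : M) : F) = (m : F) := by simp
      simp only [e1, e2, hxM]
      rw [haddF, add_comm]
    have hDadd : D (∑ s, (v s : M) * xM (ρ s)) = (m : M) * D (xM j) := by
      rw [haddM, map_sub, Derivation.map_algebraMap, sub_zero,
        show (m : M) * xM j = (m : ℕ) • xM j from (nsmul_eq_mul _ _).symm, map_nsmul, nsmul_eq_mul]
    -- multiplicative relation in `M`
    have hmulF : exp (x j) ^ m = exp ((m : F) * b) * ∏ s, exp (x (ρ s)) ^ (v s) := by
      rw [← exp_nsmul, nsmul_eq_mul, haddF, exp_add, exp_sum_intCast_mul]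
    have hmulM : yM j ^ m = algebraMap L M ⟨exp ((m : F) * b), hcL⟩ * ∏ s, yM (ρ s) ^ (v s) := by
      apply Subtype.ext
      rw [SubmonoidClass.coe_pow, MulMemClass.coe_mul, hamap, hyM, hmulF]
      congr 1
      rw [IntermediateField.coe_prod]
      refine Finset.prod_congr rfl fun s _ => ?_
      rw [← hyM (ρ s)]
      exact (map_zpow₀ (algebraMap M F) (yM (ρ s)) (v s)).symm
    -- differentiate the multiplicative relation
    have hDprod : D (∏ s, yM (ρ s) ^ (v s)) =
        (∏ s, yM (ρ s) ^ (v s)) * D (∑ s, (v s : M) * xM (ρ s)) :=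
      derivation_prod_zpow_of_exp D (fun s => xM (ρ s)) (fun s => yM (ρ s)) (fun s => hy0 (ρ s)) hDρ v
    have hD1 : D (yM j ^ m) = yM j ^ m * ((m : M) * D (xM j)) := by
      conv_lhs => rw [hmulM]
      rw [Derivation.leibniz, Derivation.map_algebraMap, smul_zero, add_zero, smul_eq_mul, hDprod,
        ← mul_assoc, ← hmulM, hDadd]
    have hD2 : D (yM j ^ m) = (m : M) * yM j ^ (m - 1) * D (yM j) := by
      rw [Derivation.leibniz_pow, nsmul_eq_mul, smul_eq_mul, mul_assoc]
    -- cancel `m yⱼ^{m-1}`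
    obtain ⟨m', rfl⟩ : ∃ m', m = m' + 1 := ⟨m - 1, (Nat.sub_add_cancel hm).symm⟩
    rw [hD2, Nat.add_sub_cancel, pow_succ] at hD1
    have hm0 : ((m' + 1 : ℕ) : M) ≠ 0 := Nat.cast_ne_zero.2 (Nat.succ_ne_zero m')
    have hp0 : yM j ^ m' ≠ 0 := pow_ne_zero _ (hy0 j)
    have := hD1
    -- `(m) * y^{m'} * D y = y^{m'} * y * (m * D x)`
    have h' : ((m' + 1 : ℕ) : M) * yM j ^ m' * (D (yM j) - yM j * D (xM j)) = 0 := by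
      rw [mul_sub, this]; ring
    rcases mul_eq_zero.1 h' with h1 | h1
    · rcases mul_eq_zero.1 h1 with h2 | h2
      · exact absurd h2 hm0
      · exact absurd h2 hp0
    · exact sub_eq_zero.1 h1
  -- injectivity of the defect map
  have hinj : Function.Injective Φ := by
    refine (injective_iff_map_eq_zero Φ).2 fun D hD => ?_
    have hE := key D hD
    -- extend `D` to a derivation of `F`
    let DF : Derivation L M F := (Algebra.linearMap M F).compDer D
    have hDF : ∀ s : M, DF s = ((D s : M) : F) := fun s => rfl
    obtain ⟨D', hD'⟩ := Derivation.exists_extension_of_charZero (R := L) (F := M) (T := F) (M := F) DF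
    let D'' : Derivation ℤ F F := D'.restrictScalars ℤ
    have hD''x : ∀ j, D'' (x j) = ((D (xM j) : M) : F) := fun j => by
      show D' (algebraMap M F (xM j)) = _
      rw [hD', hDF]
    have hD''y : ∀ j, D'' (exp (x j)) = ((D (yM j) : M) : F) := fun j => by
      show D' (algebraMap M F (yM j)) = _
      rw [hD', hDF]
    have hDS : ∀ s ∈ S, D'' s = 0 := fun s hs => by
      show D' s = 0
      have : s = algebraMap L F ⟨s, hS hs⟩ := rfl
      rw [this, Derivation.map_algebraMap]
    have hDE : ∀ j, D'' (exp (x j)) = exp (x j) * D'' (x j) := fun j => by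
      rw [hD''y, hD''x, hE j, MulMemClass.coe_mul, hyM]
    have hx0 : ∀ j, D (xM j) = 0 := fun j => by
      have h := derivation_apply_eq_zero_of_khovanskii_sol hcoeff heval hdet D'' hDS hDE j
      rw [hD''x] at h
      exact_mod_cast h
    have hy0' : ∀ j, D (yM j) = 0 := fun j => by rw [hE j, hx0 j, mul_zero]
    refine derivation_eq_zero_of_adjoin_eq_top (F := L) D (fun c => D.map_algebraMap c)
      (S := ((↑) : M → F) ⁻¹' range z) (fun s hs => ?_)
      (Literature.NumberTheory.Transcendental.IntermediateField.adjoin_preimage_val_eq_top (F := L) (range z))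
    obtain ⟨t, ht⟩ := hs
    have : s = zM t := Subtype.ext ht.symm
    rw [this]
    rcases t with j | j
    · exact hx0 j
    · exact hy0' j
  -- dimension count
  haveI : Module.Finite M (Derivation L M M) := Module.Finite.of_injective Φ hinj
  have h1 : Module.finrank M (Derivation L M M) ≤ k := by
    have := LinearMap.finrank_le_finrank_of_injective hinj
    simpa using this
  calc Algebra.trdeg L M ≤ (Module.finrank M (Derivation L M M) : Cardinal) :=
        trdeg_le_finrank_derivation
    _ ≤ k := by exact_mod_cast h1

/-- **The transcendence bound for Khovanskii systems** (Kirby 2010, proof of Prop. 4.7 /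
Lemma 4.8, in dual form; the statement of `GammaField.trdeg_adjoin_le_of_khovanskii` of
`EclPredim.lean`, re-proved over a buildable import cone, with the generating set of `L(x̄, e^{x̄})` written as
`range x ∪ range (exp ∘ x)`). Let `Λ ≤ F` be a `ℚ`-subspace with Γ-field
`L = ℚ(Λ, exp Λ)` (`GammaField.fieldOf`), and let `x̄ ∈ Fⁿ` be a non-degenerate solution of a
Khovanskii system `fᵢ(x̄, e^{x̄}) = 0` (`i < n`) whose coefficients lie in the subring generated by
`S ⊆ L` (non-vanishing exponential Jacobian `det(∂fᵢ/∂Xⱼ + Yⱼ ∂fᵢ/∂Yⱼ)(x̄, e^{x̄})`). If every `xⱼ`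
lies in `Λ + ℚ·{x_{ρ s} : s < k}` for a sub-tuple `x ∘ ρ`, then `trdeg_L L(x̄, e^{x̄}) ≤ k`: the
`M`-linear map sending an `L`-derivation `D` of `M = L(x̄, e^{x̄})` to its exponential defects
`(D e^{x_{ρ s}} - e^{x_{ρ s}} D x_{ρ s})_{s < k}` is injective (vanishing defects propagate along the
`ℚ`-linear relations modulo `Λ`, then the chain rule through the system forces `D x̄ = 0`), and
`trdeg_L M ≤ dim_M Der_L(M)`. [cite: Kirby2010, Prop. 4.7, Lemma 4.8 and §7 (proof of Thm. 1.3)] -/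
theorem trdeg_adjoin_le_of_khovanskii (hS : S ⊆ (fieldOf Λ : Set F))
    (hcoeff : ∀ i m, (f i).coeff m ∈ Subring.closure S)
    (heval : ∀ i, eval (Sum.elim x (exp ∘ x)) (f i) = 0)
    (hdet : (Matrix.of fun i j => eval (Sum.elim x (exp ∘ x)) (expPDeriv j (f i))).det ≠ 0)
    {k : ℕ} {ρ : Fin k → Fin n}
    (hspan : ∀ j, x j ∈ Λ ⊔ Submodule.span ℚ (range (x ∘ ρ))) :
    Algebra.trdeg (fieldOf Λ)
        (IntermediateField.adjoin (fieldOf Λ) (range x ∪ range (exp ∘ x))) ≤ k := by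
  rw [← Set.Sum.elim_range]
  exact trdeg_adjoin_le_of_khovanskii_sumElim Λ hS hcoeff heval hdet hspan

end TrdegBound

end Literature.NumberTheory.Transcendental.KhovanskiiBound

end
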